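import Literature.NumberTheory.GaloisCohomology.Howard2004.UnramifiedSelfOrthogonalReadout
import Literature.NumberTheory.GaloisRepresentations.ContinuousH2JointInjective
import HarnessLib

/-!
# Howard 2004, H.4 descent: the value tower `Q_j = H²(K_v, R_j(1))` of the induced local pairings satisfies
# «`p · q = 0 ⇒ H²(reduce) q = 0`» (proofs file)

Topic `NumberTheory/GaloisCohomology/Howard2004` (cell `pub/bsd-print-x9`; the clause `hQ` of the saturated-condition descent
`Tower.levelCondition_mem_iff_forall_pairing_eq_zero` / `pairing_eq_zero_of_mem_levelCondition` for `SatisfiesH.h4` at `v ∈ Σ`,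
H4-DESCENT-RECIPE item 1).  THEOREMS ONLY; no definition, no named fact, no instance, no notation, no `sorry`.

Howard, §1.3 H.4 and §1.6 [arXiv:1202.6340 p. 7 L78–82, p. 11 L33–38]: the induced local pairings of the levels `T^{(k)}`
take values in `H²(K_v, R_k(1))` and are compatible with the reductions `R_{k+1} → R_k`.  The descent needs that the value
tower has «no `p`-torsion in the limit»: a class `q ∈ H²(K_v, R_{k+1}(1))` with `p q = 0` dies in `H²(K_v, R_k(1))`.  For
Howard's level rings (`R_{k+1}` killed by `p^{k+1}` and DUALIZED by a finite family of characters `exp ∘ λ_{r_i}`, i.e.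
`R_{k+1}(1) ≅ μ_{p^{k+1}}^{⊕ι}` as `Γ_K`-modules — the readout data of `UnramifiedSelfOrthogonalReadout`) this holds:
`H²(K_v, μ_{p^{k+1}}) ≅ ℤ/p^{k+1}` (a local invariant map `ι_v`, bijective — the conjunct `IsPerfect` of the Poitou–Tate named
fact), so `p`-torsion classes are `p^k`-multiples, and `H²(K_v, R_k(1))` is killed by `p^k`.

* `twoCohomology_nsmul_eq_zero_of_forall` — `n · H²(G, V) = 0` if `n · V = 0`;
* `ZMod.exists_eq_pow_smul_of_prime_smul_eq_zero` — in `ℤ/p^{k+1}`, `p x = 0 ⇒ x = p^k y`;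
* **`DualityDatum.cohomologyMap_two_eq_zero_of_prime_nsmul_eq_zero`** — the clause `hQ` for ANY additive, twist-intertwining
  `φ : R₁ → R₂` into a ring killed by `p^k`, `R₁` dualized at level `p^{k+1}`, at every finite place (NO coherence between the
  local invariant maps of different levels is used).

HONEST FRAMING: conditional on a bijective `ι_v : H²(K_v, μ_{p^{k+1}}) → ℤ/p^{k+1}` (the tree's `LocalInvariants`/`IsPerfect`).
BSD is not proved by any of this.

References: [Howard2004HeegnerKolyvagin] §1.3 H.4, §1.6; [MilneADT2006] Ch. I, Cor. 2.3 (`H²(K_v, μ_n) ≅ ℤ/n`);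
[Brown1982CohomologyGroups] III §6 (cohomology and finite products).
-/

set_option autoImplicit false

noncomputable section

open CategoryTheory Function NumberField IsDedekindDomain Field
open scoped ContRepresentation NumberField

namespace Literature.NumberTheory.GaloisCohomology.Howard2004

open Literature.NumberTheory.GaloisRepresentations
open Literature.NumberTheory.GaloisRepresentations.DiscreteGaloisModule

variable {K : Type} [Field K] [NumberField K]
  {M₁ : Type} [AddCommGroup M₁] [TopologicalSpace M₁] [DiscreteTopology M₁]
  {M₂ : Type} [AddCommGroup M₂] [TopologicalSpace M₂] [DiscreteTopology M₂]
  {R₁ : Type} [CommRing R₁] [Module R₁ M₁] [TopologicalSpace R₁] [DiscreteTopology R₁]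
  {R₂ : Type} [CommRing R₂] [Module R₂ M₂] [TopologicalSpace R₂] [DiscreteTopology R₂]
  {p : ℕ} [hp : Fact p.Prime] [Algebra ℤ_[p] R₁] [Algebra ℤ_[p] R₂] {cd : ConjugationDatum K}
  {ρ₁ : DiscreteGaloisModule K M₁} {ρ₂ : DiscreteGaloisModule K M₂}

/-! ## §0 Generic lemmas -/

/-- **`n · H²(G, V) = 0` when `n · V = 0`** (classes of continuous inhomogeneous `2`-cocycles with values in `V`).
[cite: SerreGaloisCohomology1997, I §2.2] -/
theorem twoCohomology_nsmul_eq_zero_of_forall {G : Type} [Group G] [TopologicalSpace G]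
    [IsTopologicalGroup G] [LocallyCompactSpace G] {V : Type} [AddCommGroup V] [TopologicalSpace V] [DiscreteTopology V]
    (τ : ContinuousRep G ℤ V) {n : ℕ} (hV : ∀ v : V, n • v = 0) (z : continuousCohomology 2 τ.toTopRep) :
    n • z = 0 := by
  obtain ⟨c, rfl⟩ := twoCocycleClass_surjective τ.toTopRep z
  have hc : n • c = 0 := Subtype.ext (ContinuousMap.ext fun q ↦ hV (c.1 q))
  rw [← twoCocycleClassₗ_apply, ← map_nsmul, hc, map_zero]

/-- In `ℤ/p^{k+1}`: an element killed by `p` is a `p^k`-multiple. [cite: MilneADT2006, Ch. I §0 (finite abelian groups)] -/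
theorem _root_.ZMod.exists_eq_pow_smul_of_prime_smul_eq_zero (p : ℕ) [hp : Fact p.Prime] (k : ℕ) (x : ZMod (p ^ (k + 1)))
    (hx : p • x = 0) : ∃ y : ZMod (p ^ (k + 1)), x = p ^ k • y := by
  haveI : NeZero (p ^ (k + 1)) := ⟨pow_ne_zero _ hp.out.ne_zero⟩
  have hdvd : p ^ (k + 1) ∣ p * x.val := by
    rw [← ZMod.natCast_eq_zero_iff, Nat.cast_mul, ZMod.natCast_zmod_val, ← nsmul_eq_mul]
    exact hx
  obtain ⟨c, hc⟩ := hdvd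
  have h2 : x.val = p ^ k * c := Nat.eq_of_mul_eq_mul_left hp.out.pos (by rw [hc]; ring)
  refine ⟨(c : ZMod (p ^ (k + 1))), ?_⟩
  rw [← ZMod.natCast_zmod_val x, h2, Nat.cast_mul, Nat.cast_pow, nsmul_eq_mul, Nat.cast_pow]


namespace DualityDatum

/-- **The clause `hQ` of the H.4 descent: `p · q = 0 ⇒ H²(reduce(1)) q = 0`.**  Let `D₁` be H.4 data over a level ring `R₁`
dualized at level `p^{k+1}` by the characters `exp ∘ λ_{r_i}` (`x ↦ (exp λ(r_i x))_i : R₁ ≅ Π_i μ_{p^{k+1}}` bijective), `D₂`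
H.4 data over a ring `R₂` killed by `p^k`, `φ : R₁ → R₂` additive intertwining the twists `R₁(1) → R₂(1)` (e.g. the reduction
`A_{m,k+2} → A_{m,k+1}`), and `v` a finite place with a bijective local invariant map `ι_v : H²(K_v, μ_{p^{k+1}}) → ℤ/p^{k+1}`.
Then every `q ∈ H²(K_v, R₁(1))` with `p · q = 0` is killed by `H²(φ)`: `q` is a `p^k`-multiple (`R₁(1) ≅ μ^{⊕ι}`,
`H²(K_v, μ_{p^{k+1}}) ≅ ℤ/p^{k+1}`) and `p^k · H²(K_v, R₂(1)) = 0`. [cite: Howard2004HeegnerKolyvagin, §1.3 H.4 and §1.6 (arXiv p. 11, L33–38)]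
[cite: MilneADT2006, Ch. I, Cor. 2.3] [cite: Brown1982CohomologyGroups, III §6] -/
theorem cohomologyMap_two_eq_zero_of_prime_nsmul_eq_zero (D₁ : DualityDatum p cd ρ₁ R₁) (D₂ : DualityDatum p cd ρ₂ R₂)
    {k : ℕ} (lam : R₁ →+ ZMod (p ^ (k + 1)))
    (hlam : ∀ (z : ℤ_[p]) (r : R₁), lam (algebraMap ℤ_[p] R₁ z * r) = PadicInt.toZModPow (k + 1) z * lam r)
    (exp : ZMod (p ^ (k + 1)) →+ MuCarrier K (p ^ (k + 1)))
    (hexp : ∀ (g : absoluteGaloisGroup K) (x : ZMod (p ^ (k + 1))),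
      exp (cyclotomicCharacterModPow K p (k + 1) g * x) = mu K (p ^ (k + 1)) g (exp x))
    {ι : Type} [Finite ι] (r : ι → R₁) (hbij : Bijective fun x : R₁ => fun i : ι => exp (lam (r i * x)))
    (hR₂ : ∀ x : R₂, p ^ k • x = 0) (φ : R₁ →+ R₂)
    (hφ : ∀ (g : absoluteGaloisGroup K) (x : R₁), φ (D₁.twistOne g x) = D₂.twistOne g (φ x))
    (v : HeightOneSpectrum (𝓞 K))
    (inv : galoisCohomology ((mu K (p ^ (k + 1))).toLocal (Sum.inr v)) 2 →+ ZMod (p ^ (k + 1)))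
    (hinv : Bijective inv) (q : galoisCohomology (D₁.twistOne.toLocal (Sum.inr v)) 2) (hq : p • q = 0) :
    ContinuousRep.cohomologyMap (D₁.twistOne.toLocal (Sum.inr v)) (D₂.twistOne.toLocal (Sum.inr v)) φ
      continuous_of_discreteTopology (fun _ z => hφ _ z) 2 q = 0 := by
  classical
  haveI : CompactSpace (absoluteGaloisGroup (Place.Completion (Sum.inr v : Place K))) := absoluteGaloisGroup_compactSpace _
  haveI := Fintype.ofFinite ι
  -- the characters and the trivialisation `e : R₁ ≃ Π_i μ`
  let π : ∀ i : ι, (D₁.twistOne.toLocal (Sum.inr v : Place K)).toTopRep ⟶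
      ((mu K (p ^ (k + 1))).toLocal (Sum.inr v : Place K)).toTopRep := fun i =>
    D₁.expLamLocalHom (lamMul lam (r i)) (lamMul_semilinear lam hlam (r i)) exp hexp (Sum.inr v)
  let e : R₁ ≃ (ι → MuCarrier K (p ^ (k + 1))) := Equiv.ofBijective _ hbij
  have hπ : ∀ (x : R₁) (i : ι), (π i).hom x = e x i := fun x i => rfl
  have he_add : ∀ x y : R₁, e (x + y) = e x + e y := fun x y ↦ by
    funext i
    change exp (lam (r i * (x + y))) = exp (lam (r i * x)) + exp (lam (r i * y))
    rw [mul_add, map_add, map_add]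
  have hs_add : ∀ a b, e.symm (a + b) = e.symm a + e.symm b := fun a b ↦
    e.injective (by rw [he_add, e.apply_symm_apply, e.apply_symm_apply, e.apply_symm_apply])
  have he_smul : ∀ (σ : absoluteGaloisGroup (Place.Completion (Sum.inr v : Place K))) (x : R₁) (i : ι),
      e ((D₁.twistOne.toLocal (Sum.inr v : Place K)) σ x) i =
        ((mu K (p ^ (k + 1))).toLocal (Sum.inr v : Place K)) σ (e x i) := fun σ x i ↦
    D₁.expLam_twistOne (lamMul lam (r i)) (lamMul_semilinear lam hlam (r i)) exp hexp _ x
  -- the inclusions `μ → R₁(1)`, `ξ ↦ e⁻¹(δ_i ξ)`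
  have he0 : e 0 = 0 := by
    have h := he_add 0 0
    rw [add_zero] at h
    exact (left_eq_add.mp h).symm ▸ rfl
  let incl : ι → (MuCarrier K (p ^ (k + 1)) →+ R₁) := fun i ↦
    { toFun := fun ξ ↦ e.symm (Pi.single i ξ)
      map_zero' := e.injective (by rw [e.apply_symm_apply, Pi.single_zero, he0])
      map_add' := fun a b ↦ by rw [Pi.single_add, hs_add] }
  have hincl : ∀ (i : ι) (σ : absoluteGaloisGroup (Place.Completion (Sum.inr v : Place K))) (ξ : MuCarrier K (p ^ (k + 1))),
      incl i (((mu K (p ^ (k + 1))).toLocal (Sum.inr v : Place K)) σ ξ) =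
        (D₁.twistOne.toLocal (Sum.inr v : Place K)) σ (incl i ξ) := by
    intro i σ ξ
    apply e.injective
    funext j
    rw [he_smul]
    change e (e.symm (Pi.single i _)) j = _
    rw [e.apply_symm_apply]
    change _ = ((mu K (p ^ (k + 1))).toLocal (Sum.inr v : Place K)) σ (e (e.symm (Pi.single i ξ)) j)
    rw [e.apply_symm_apply]
    by_cases hij : j = i
    · subst hij; rw [Pi.single_eq_same, Pi.single_eq_same]
    · rw [Pi.single_eq_of_ne hij, Pi.single_eq_of_ne hij, map_zero]
  let Incl : ∀ i : ι, ((mu K (p ^ (k + 1))).toLocal (Sum.inr v : Place K)).toTopRep ⟶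
      (D₁.twistOne.toLocal (Sum.inr v : Place K)).toTopRep := fun i =>
    TopRep.ofHom ⟨⟨(incl i).toIntLinearMap, continuous_of_discreteTopology⟩,
      fun σ => ContinuousLinearMap.ext fun ξ => hincl i σ ξ⟩
  -- the induced maps on `H²`, as additive maps
  let F : ι → (galoisCohomology (D₁.twistOne.toLocal (Sum.inr v : Place K)) 2 →+
      galoisCohomology ((mu K (p ^ (k + 1))).toLocal (Sum.inr v : Place K)) 2) := fun i =>
    (cohomologyMap (π i) 2).hom.toAddMonoidHom
  let G : ι → (galoisCohomology ((mu K (p ^ (k + 1))).toLocal (Sum.inr v : Place K)) 2 →+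
      galoisCohomology (D₁.twistOne.toLocal (Sum.inr v : Place K)) 2) := fun i =>
    (cohomologyMap (Incl i) 2).hom.toAddMonoidHom
  -- `H²(π_j) ∘ H²(Incl_i) = δ_{ij}`
  have hcomp : ∀ (i j : ι) (w : galoisCohomology ((mu K (p ^ (k + 1))).toLocal (Sum.inr v : Place K)) 2),
      F j (G i w) = if j = i then w else 0 := by
    intro i j w
    obtain ⟨c, rfl⟩ := twoCocycleClass_surjective _ w
    change cohomologyMap (π j) 2 (cohomologyMap (Incl i) 2 (twoCocycleClass _ c)) = _
    rw [cohomologyMap_twoCocycleClass, cohomologyMap_twoCocycleClass]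
    have hval : ∀ στ, (contTwoCocycles.pullback (ContinuousMonoidHom.id _) (resIdHom (π j))
        (contTwoCocycles.pullback (ContinuousMonoidHom.id _) (resIdHom (Incl i)) c)).1 στ =
          if j = i then c.1 στ else 0 := by
      rintro ⟨σ, τ⟩
      rw [pullback₂_id_resIdHom_apply, pullback₂_id_resIdHom_apply, hπ]
      change e (e.symm (Pi.single i (c.1 (σ, τ)))) j = _
      rw [e.apply_symm_apply]
      by_cases hij : j = i
      · subst hij; rw [Pi.single_eq_same, if_pos rfl]
      · rw [Pi.single_eq_of_ne hij, if_neg hij]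
    by_cases hij : j = i
    · rw [if_pos hij]
      congr 1
      exact Subtype.ext (ContinuousMap.ext fun στ => by rw [hval, if_pos hij])
    · rw [if_neg hij]
      have h0 : contTwoCocycles.pullback (ContinuousMonoidHom.id _) (resIdHom (π j))
          (contTwoCocycles.pullback (ContinuousMonoidHom.id _) (resIdHom (Incl i)) c) = 0 :=
        Subtype.ext (ContinuousMap.ext fun στ => by rw [hval, if_neg hij]; rfl)
      rw [h0, twoCocycleClass_zero]
      rfl
  -- each coordinate of `q` is a `p^k`-multiple
  have hdiv : ∀ i, ∃ w : galoisCohomology ((mu K (p ^ (k + 1))).toLocal (Sum.inr v : Place K)) 2,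
      F i q = p ^ k • w := by
    intro i
    have hz : p • F i q = 0 := (map_nsmul (F i) p q).symm.trans ((congrArg (F i) hq).trans (map_zero _))
    have hz' : p • inv (F i q) = 0 := (map_nsmul inv p _).symm.trans ((congrArg inv hz).trans (map_zero _))
    obtain ⟨t, ht⟩ := ZMod.exists_eq_pow_smul_of_prime_smul_eq_zero p k (inv (F i q)) hz'
    obtain ⟨w, hw⟩ := hinv.2 t
    exact ⟨w, hinv.1 (ht.trans (by rw [map_nsmul, hw]))⟩
  choose w hw using hdiv
  -- a preimage `W` of the family `(w_i)` and `q = p^k • W`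
  let W : galoisCohomology (D₁.twistOne.toLocal (Sum.inr v : Place K)) 2 := ∑ i, G i (w i)
  have hW : ∀ j, F j W = w j := fun j ↦ by
    change F j (∑ i, G i (w i)) = w j
    rw [map_sum]
    simp_rw [hcomp]
    rw [Finset.sum_ite_eq, if_pos (Finset.mem_univ _)]
  have hqW : q = p ^ k • W := by
    rw [← sub_eq_zero]
    refine twoCohomology_eq_zero_of_forall_cohomologyMap_eq_zero π (fun y => e.symm y)
      continuous_of_discreteTopology (fun y i => ?_) (fun x => e.symm_apply_apply x) _ fun i => ?_
    · change e (e.symm y) i = y i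
      rw [Equiv.apply_symm_apply]
    · change F i (q - p ^ k • W) = 0
      rw [map_sub, map_nsmul, hW, hw i, sub_self]
  calc ContinuousRep.cohomologyMap (D₁.twistOne.toLocal (Sum.inr v)) (D₂.twistOne.toLocal (Sum.inr v)) φ
          continuous_of_discreteTopology (fun _ z => hφ _ z) 2 q
      _ = p ^ k • ContinuousRep.cohomologyMap (D₁.twistOne.toLocal (Sum.inr v)) (D₂.twistOne.toLocal (Sum.inr v)) φ
          continuous_of_discreteTopology (fun _ z => hφ _ z) 2 W := by rw [hqW]; exact map_nsmul _ _ _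
      _ = 0 := twoCohomology_nsmul_eq_zero_of_forall _ (fun x ↦ hR₂ x) _

end DualityDatum

end Literature.NumberTheory.GaloisCohomology.Howard2004

end
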